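import Summits.BirchSwinnertonDyer.Rank1Residual.F1Sign2.OddBranchFEAtTwoFinite
import HarnessLib

/-!
# `OddBranchFEAtTwoTransport` — Part 3 of the odd-branch functional equation at `2` (g3): §5 the `2`-adic exponents `a = −2/3`,
`b = −1/3`, and §6 the transport of the odd congruences `θ⁻_n ≡ −(u_n L♯₋ + v_n L♭₋) (mod ω_n)` under
the involution `ι : T ↦ (1+T)⁻¹ − 1`. See Part 1 (`OddBranchFEAtTwoPrelim`) for the overview.

TURNKEY filing by the typer seat `bsd-f1-sign2-ty` (D-ty-6, part 3/6 of -an g3's kernel file `OddFE.lean`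
200de6ab6bb130d9, pre-split by the planner): `HOME/MEMO-an-data/g3/split/OddBranchFEAtTwoTransport.lean` sha16 f33916865f43c917
(joint farm checks `JointA_parts1to4` 000c30d5de228c06 / `JointB_parts1to6` cbbe6a2064807d53: rc 0, 0 warnings, 0 sorries),
re-filed VERBATIM. PROOF-ONLY module (theorems; no definition, no named fact). REF2-PLACEMENT-v8 §0: the odd-branch
functional equation at 2 is IN PRINT (Sprung, ANT 11 (2017), Cor. 4.14 at (p, i) = (2, 1); Sprung arXiv:1211.1352 Thm 3.16 /
Cor 3.17) — formalised here, not new; beyond-print theorem: no for the FE itself (value corollaries: REF2 placing).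
-/

set_option autoImplicit false

noncomputable section

open scoped MatrixGroups ModularForm

open CongruenceSubgroup PowerSeries Filter Topology
  Literature.NumberTheory.EllipticCurves Literature.NumberTheory.EllipticCurves.ModularForms
  Literature.NumberTheory.EllipticCurves.Sprung2017 Literature.Barriers.BirchSwinnertonDyer

namespace Summit.BirchSwinnertonDyer.Rank1Residual.F1Sign2

/-! ## §5. The `2`-adic exponents `a = −2/3`, `b = −1/3` (copies of the even file's §5) -/

section Exponents

/-- `3` is a unit of `ℤ₂`, so `3x = t` is solvable. [folklore] -/
theorem exists_three_mul_eq (t : ℤ_[2]) : ∃ x : ℤ_[2], 3 * x = t := by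
  have h3 : IsUnit (3 : ℤ_[2]) := by
    rw [PadicInt.isUnit_iff]
    have h : ‖((3 : ℤ) : ℤ_[2])‖ = 1 := by
      rw [PadicInt.norm_intCast_eq_one_iff]
      decide
    exact_mod_cast h
  obtain ⟨u, hu⟩ := h3
  exact ⟨(↑u⁻¹ : ℤ_[2]) * t, by rw [← mul_assoc, ← hu, Units.mul_inv, one_mul]⟩

/-- `3·⌊2ⁿ/3⌋ + 2 = 2ⁿ` for odd `n`. [folklore] -/
private theorem three_mul_two_pow_div_three_odd (k : ℕ) :
    3 * (2 ^ (2 * k + 1) / 3) + 2 = 2 ^ (2 * k + 1) := by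
  have h : 2 ^ (2 * k + 1) % 3 = 2 := by
    rw [pow_succ, pow_mul, Nat.mul_mod, Nat.pow_mod]; norm_num
  have := Nat.div_add_mod (2 ^ (2 * k + 1)) 3
  omega

/-- `3·⌊2ⁿ/3⌋ + 1 = 2ⁿ` for even `n`. [folklore] -/
private theorem three_mul_two_pow_div_three_even (k : ℕ) :
    3 * (2 ^ (2 * k) / 3) + 1 = 2 ^ (2 * k) := by
  have h : 2 ^ (2 * k) % 3 = 1 := by
    rw [pow_mul, Nat.pow_mod]; norm_num
  have := Nat.div_add_mod (2 ^ (2 * k)) 3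
  omega

/-- `a = −2/3`: `a ≡ ⌊2ⁿ/3⌋ (mod 2ⁿ)` for odd `n`. [folklore] -/
private theorem toZModPow_eq_two_pow_div_three_of_odd {a : ℤ_[2]} (ha : 3 * a = -2) (k : ℕ) :
    PadicInt.toZModPow (2 * k + 1) a = ((2 ^ (2 * k + 1) / 3 : ℕ) : ZMod (2 ^ (2 * k + 1))) := by
  set n := 2 * k + 1 with hn
  obtain ⟨u, hu⟩ := exists_three_mul_eq (1 : ℤ_[2])
  have hdiff : a - ((2 ^ n / 3 : ℕ) : ℤ_[2]) = (2 : ℤ_[2]) ^ n * (-u) := by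
    have h3 : (3 : ℤ_[2]) * ((2 ^ n / 3 : ℕ) : ℤ_[2]) + 2 = (2 : ℤ_[2]) ^ n := by
      exact_mod_cast three_mul_two_pow_div_three_odd k
    linear_combination u * ha - u * h3 - (a - ((2 ^ n / 3 : ℕ) : ℤ_[2])) * hu
  have hker : a - ((2 ^ n / 3 : ℕ) : ℤ_[2]) ∈ RingHom.ker (PadicInt.toZModPow (p := 2) n) := by
    rw [PadicInt.ker_toZModPow, Ideal.mem_span_singleton]
    exact ⟨-u, by rw [hdiff]; push_cast; ring⟩
  rw [RingHom.mem_ker, map_sub, map_natCast, sub_eq_zero] at hker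
  exact hker

/-- `b = −1/3`: `b ≡ ⌊2ⁿ/3⌋ (mod 2ⁿ)` for even `n`. [folklore] -/
private theorem toZModPow_eq_two_pow_div_three_of_even {b : ℤ_[2]} (hb : 3 * b = -1) (k : ℕ) :
    PadicInt.toZModPow (2 * k) b = ((2 ^ (2 * k) / 3 : ℕ) : ZMod (2 ^ (2 * k))) := by
  set n := 2 * k with hn
  obtain ⟨u, hu⟩ := exists_three_mul_eq (1 : ℤ_[2])
  have hdiff : b - ((2 ^ n / 3 : ℕ) : ℤ_[2]) = (2 : ℤ_[2]) ^ n * (-u) := by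
    have h3 : (3 : ℤ_[2]) * ((2 ^ n / 3 : ℕ) : ℤ_[2]) + 1 = (2 : ℤ_[2]) ^ n := by
      exact_mod_cast three_mul_two_pow_div_three_even k
    linear_combination u * hb - u * h3 - (b - ((2 ^ n / 3 : ℕ) : ℤ_[2])) * hu
  have hker : b - ((2 ^ n / 3 : ℕ) : ℤ_[2]) ∈ RingHom.ker (PadicInt.toZModPow (p := 2) n) := by
    rw [PadicInt.ker_toZModPow, Ideal.mem_span_singleton]
    exact ⟨-u, by rw [hdiff]; push_cast; ring⟩
  rw [RingHom.mem_ker, map_sub, map_natCast, sub_eq_zero] at hker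
  exact hker

end Exponents

/-! ## §6. Transport of the odd congruences under `ι` (the even file's §6, abstracted over the
finite-level functional equation and its sign) -/

section Transport

/-- `E^j − (1+T)^{−x} ∈ ω_m Λ` when `toZModPow m x = j`. [folklore] -/
private theorem exists_E_pow_sub_binomialSeries_neg_eq {m : ℕ} {x : ℤ_[2]} {j : ℕ}
    (hx : PadicInt.toZModPow m x = (j : ZMod (2 ^ m))) :
    ∃ q : ℤ_[2]⟦X⟧, ((invOnePlusSubOne : ℤ_[2]⟦X⟧) + 1) ^ j -
        PowerSeries.binomialSeries ℤ_[2] (-x) = ((1 + X : ℤ_[2]⟦X⟧) ^ (2 ^ m) - 1) * q := by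
  obtain ⟨q₁, hq₁⟩ := exists_binomialSeries_sub_pow_eq hx
  have hBB : PowerSeries.binomialSeries ℤ_[2] (-x) * PowerSeries.binomialSeries ℤ_[2] x = 1 := by
    rw [← PowerSeries.binomialSeries_add, neg_add_cancel, PowerSeries.binomialSeries_zero]
  have hPE := one_add_X_pow_mul_E_pow (R := ℤ_[2]) j
  refine ⟨((invOnePlusSubOne : ℤ_[2]⟦X⟧) + 1) ^ j * PowerSeries.binomialSeries ℤ_[2] (-x) * q₁, ?_⟩
  linear_combination (((invOnePlusSubOne : ℤ_[2]⟦X⟧) + 1) ^ j *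
      PowerSeries.binomialSeries ℤ_[2] (-x)) * hq₁ -
    ((invOnePlusSubOne : ℤ_[2]⟦X⟧) + 1) ^ j * hBB + PowerSeries.binomialSeries ℤ_[2] (-x) * hPE

variable {N : ℕ} [NeZero N] {f : CuspForm (Gamma0 N) 2}

/-- The `U`-term of the transported congruence. [folklore] -/
private theorem exists_sharp_term_transport {m : ℕ} {c a : ℤ_[2]} (ha : 3 * a = -2) (σ : ℤ)
    (L : IwasawaAlgebra 2) :
    ∃ δ : IwasawaAlgebra 2,
      iwasawaToPowerSeries 2 (toIwasawa 2 (sharpPoly 0 2 m)) *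
          (((σ : ℤ) : ℚ_[2]⟦X⟧) * ((invOnePlusSubOne : ℚ_[2]⟦X⟧) + 1) ^ (PadicInt.toZModPow m c).val *
            ((invOnePlusSubOne : ℚ_[2]⟦X⟧) + 1) ^ (2 ^ m / 3) *
            iwasawaToPowerSeries 2 (L.subst (invOnePlusSubOne : ℤ_[2]⟦X⟧))) -
        iwasawaToPowerSeries 2 (toIwasawa 2 (sharpPoly 0 2 m)) *
          (((σ : ℤ) : ℚ_[2]⟦X⟧) *
            iwasawaToPowerSeries 2 (PowerSeries.binomialSeries ℤ_[2] (-(c + a))) *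
            iwasawaToPowerSeries 2 (L.subst (invOnePlusSubOne : ℤ_[2]⟦X⟧))) =
      iwasawaToPowerSeries 2 (((cyclotomicOmega 2 m).map (Int.castRingHom ℤ_[2]) :
        Polynomial ℤ_[2]) : ℤ_[2]⟦X⟧) * iwasawaToPowerSeries 2 δ := by
  haveI : NeZero (2 ^ m) := ⟨pow_ne_zero _ two_ne_zero⟩
  rcases Nat.even_or_odd m with ⟨k, hk⟩ | ⟨k, hk⟩
  · have hu : sharpPoly 0 2 m = 0 := by rw [hk, ← two_mul]; exact sharpPoly_zero_two_mul 2 k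
    refine ⟨0, ?_⟩
    rw [hu, map_zero, map_zero]; ring
  · subst hk
    have hx : PadicInt.toZModPow (2 * k + 1) (c + a) =
        (((PadicInt.toZModPow (2 * k + 1) c).val + 2 ^ (2 * k + 1) / 3 : ℕ) :
          ZMod (2 ^ (2 * k + 1))) := by
      rw [map_add, toZModPow_eq_two_pow_div_three_of_odd ha k, Nat.cast_add, ZMod.natCast_zmod_val]
    obtain ⟨q₁, hq₁⟩ := exists_E_pow_sub_binomialSeries_neg_eq hx
    refine ⟨(σ : IwasawaAlgebra 2) * toIwasawa 2 (sharpPoly 0 2 (2 * k + 1)) *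
      L.subst (invOnePlusSubOne : ℤ_[2]⟦X⟧) * q₁, ?_⟩
    have hK := congrArg (iwasawaToPowerSeries 2) hq₁
    simp only [map_sub, map_mul, map_pow, map_add, map_one, PowerSeries.map_X,
      iwasawaToPowerSeries_invOnePlusSubOne] at hK
    rw [coe_map_cyclotomicOmega]
    simp only [map_sub, map_mul, map_pow, map_add, map_one, PowerSeries.map_X, map_intCast]
    linear_combination (iwasawaToPowerSeries 2 (toIwasawa 2 (sharpPoly 0 2 (2 * k + 1))) *
      ((σ : ℤ) : ℚ_[2]⟦X⟧) * iwasawaToPowerSeries 2 (L.subst (invOnePlusSubOne : ℤ_[2]⟦X⟧))) * hK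

/-- The `V`-term of the transported congruence. [folklore] -/
private theorem exists_flat_term_transport {m : ℕ} {c b : ℤ_[2]} (hb : 3 * b = -1) (σ : ℤ)
    (L : IwasawaAlgebra 2) :
    ∃ δ : IwasawaAlgebra 2,
      iwasawaToPowerSeries 2 (toIwasawa 2 (flatPoly 0 2 m)) *
          (((σ : ℤ) : ℚ_[2]⟦X⟧) * ((invOnePlusSubOne : ℚ_[2]⟦X⟧) + 1) ^ (PadicInt.toZModPow m c).val *
            ((invOnePlusSubOne : ℚ_[2]⟦X⟧) + 1) ^ (2 ^ m / 3) *
            iwasawaToPowerSeries 2 (L.subst (invOnePlusSubOne : ℤ_[2]⟦X⟧))) -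
        iwasawaToPowerSeries 2 (toIwasawa 2 (flatPoly 0 2 m)) *
          (((σ : ℤ) : ℚ_[2]⟦X⟧) *
            iwasawaToPowerSeries 2 (PowerSeries.binomialSeries ℤ_[2] (-(c + b))) *
            iwasawaToPowerSeries 2 (L.subst (invOnePlusSubOne : ℤ_[2]⟦X⟧))) =
      iwasawaToPowerSeries 2 (((cyclotomicOmega 2 m).map (Int.castRingHom ℤ_[2]) :
        Polynomial ℤ_[2]) : ℤ_[2]⟦X⟧) * iwasawaToPowerSeries 2 δ := by
  haveI : NeZero (2 ^ m) := ⟨pow_ne_zero _ two_ne_zero⟩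
  rcases Nat.even_or_odd m with ⟨k, hk⟩ | ⟨k, hk⟩
  · rw [← two_mul] at hk
    subst hk
    have hx : PadicInt.toZModPow (2 * k) (c + b) =
        (((PadicInt.toZModPow (2 * k) c).val + 2 ^ (2 * k) / 3 : ℕ) : ZMod (2 ^ (2 * k))) := by
      rw [map_add, toZModPow_eq_two_pow_div_three_of_even hb k, Nat.cast_add,
        ZMod.natCast_zmod_val]
    obtain ⟨q₁, hq₁⟩ := exists_E_pow_sub_binomialSeries_neg_eq hx
    refine ⟨(σ : IwasawaAlgebra 2) * toIwasawa 2 (flatPoly 0 2 (2 * k)) *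
      L.subst (invOnePlusSubOne : ℤ_[2]⟦X⟧) * q₁, ?_⟩
    have hK := congrArg (iwasawaToPowerSeries 2) hq₁
    simp only [map_sub, map_mul, map_pow, map_add, map_one, PowerSeries.map_X,
      iwasawaToPowerSeries_invOnePlusSubOne] at hK
    rw [coe_map_cyclotomicOmega]
    simp only [map_sub, map_mul, map_pow, map_add, map_one, PowerSeries.map_X, map_intCast]
    linear_combination (iwasawaToPowerSeries 2 (toIwasawa 2 (flatPoly 0 2 (2 * k))) *
      ((σ : ℤ) : ℚ_[2]⟦X⟧) * iwasawaToPowerSeries 2 (L.subst (invOnePlusSubOne : ℤ_[2]⟦X⟧))) * hK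
  · have hv : flatPoly 0 2 m = 0 := by rw [hk]; exact flatPoly_zero_two_mul_add_one 2 k
    refine ⟨0, ?_⟩
    rw [hv, map_zero, map_zero]; ring

omit [NeZero N] in
/-- **Transport of the ODD Sprung congruences under `T ↦ T^ι` (`p = 2`, weights of `a₂ = 0`).**
If the odd Mazur–Tate elements satisfy a doubled finite-level functional equation
`2(θ⁻_m(T^ι) − ε (1+T)^{c_m} θ⁻_m) ∈ ω_m Λ` for all `m` with a sign `ε`, `ε² = 1`
(`exists_two_mul_mazurTateElementOdd_fe`: `ε = −σ η_N`), and `(L♯₋, L♭₋)` satisfies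
`θ⁻_m ≡ −(u_m L♯₋ + v_m L♭₋) (mod ω_m)` at every level, then so does
`(ε(1+T)^{−(c+a)}L♯₋(T^ι), ε(1+T)^{−(c+b)}L♭₋(T^ι))` (`3a = −2`, `3b = −1`). Verbatim the even file's
`isSprungPair_two_zero_transport`. [cite: Sprung2017, Thm. 1.12 and Cor. 4.4 (shape of the congruences)] -/
theorem isSprungPairOdd_two_zero_transport {ε : ℤ} (hε : ε ^ 2 = 1) {c a b : ℤ_[2]}
    (ha : 3 * a = -2) (hb : 3 * b = -1)
    (hfe : ∀ m : ℕ, ∃ r : IwasawaAlgebra 2,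
      PowerSeries.C (2 : ℚ_[2]) *
          ((((mazurTateElementOdd f 2 m).map (algebraMap ℚ ℚ_[2]) : Polynomial ℚ_[2]) :
              ℚ_[2]⟦X⟧).subst (invOnePlusSubOne : ℚ_[2]⟦X⟧) -
            PowerSeries.C ((ε : ℤ) : ℚ_[2]) * (1 + X : ℚ_[2]⟦X⟧) ^ (PadicInt.toZModPow m c).val *
              (((mazurTateElementOdd f 2 m).map (algebraMap ℚ ℚ_[2]) : Polynomial ℚ_[2]) :
                ℚ_[2]⟦X⟧)) =
        iwasawaToPowerSeries 2 (((cyclotomicOmega 2 m).map (Int.castRingHom ℤ_[2]) :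
          PowerSeries ℤ_[2])) * iwasawaToPowerSeries 2 r)
    {Ls Lf : IwasawaAlgebra 2} (h : IsSprungPairOdd f 2 0 Ls Lf) :
    IsSprungPairOdd f 2 0
      ((ε : IwasawaAlgebra 2) * PowerSeries.binomialSeries ℤ_[2] (-(c + a)) *
        Ls.subst (invOnePlusSubOne : ℤ_[2]⟦X⟧))
      ((ε : IwasawaAlgebra 2) * PowerSeries.binomialSeries ℤ_[2] (-(c + b)) *
        Lf.subst (invOnePlusSubOne : ℤ_[2]⟦X⟧)) := by
  classical
  have hιK := hasSubst_invOnePlusSubOne (R := ℚ_[2])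
  intro m
  obtain ⟨e, q, hq⟩ := h m
  obtain ⟨r, hr⟩ := hfe m
  obtain ⟨δU, hδU⟩ := exists_sharp_term_transport (m := m) (c := c) ha ε Ls
  obtain ⟨δV, hδV⟩ := exists_flat_term_transport (m := m) (c := c) hb ε Lf
  refine ⟨e + 1, -2 * (ε : IwasawaAlgebra 2) *
    ((invOnePlusSubOne : ℤ_[2]⟦X⟧) + 1) ^ (PadicInt.toZModPow m c).val *
    ((invOnePlusSubOne : ℤ_[2]⟦X⟧) + 1) ^ (2 ^ m) * q.subst (invOnePlusSubOne : ℤ_[2]⟦X⟧) -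
    2 ^ e * (ε : IwasawaAlgebra 2) * ((invOnePlusSubOne : ℤ_[2]⟦X⟧) + 1) ^
      (PadicInt.toZModPow m c).val * r - 2 ^ (e + 1) * (δU + δV), ?_⟩
  simp only [Polynomial.map_neg, Polynomial.map_one, Polynomial.coe_neg, Polynomial.coe_one,
    neg_one_mul, map_neg, sub_neg_eq_add, map_add, map_sub, map_mul, map_pow, Nat.cast_ofNat,
    map_ofNat, map_intCast, map_one, iwasawaToPowerSeries_invOnePlusSubOne] at hq ⊢
  rw [map_ofNat, map_intCast] at hr
  -- `ι(ω) = −E^{2^m} ω`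
  have hSω : (iwasawaToPowerSeries 2 (((cyclotomicOmega 2 m).map (Int.castRingHom ℤ_[2]) :
      Polynomial ℤ_[2]) : ℤ_[2]⟦X⟧)).subst (invOnePlusSubOne : ℚ_[2]⟦X⟧) =
        -((invOnePlusSubOne : ℚ_[2]⟦X⟧) + 1) ^ (2 ^ m) *
          iwasawaToPowerSeries 2 (((cyclotomicOmega 2 m).map (Int.castRingHom ℤ_[2]) :
            Polynomial ℤ_[2]) : ℤ_[2]⟦X⟧) := by
    have hωP : iwasawaToPowerSeries 2 (((cyclotomicOmega 2 m).map (Int.castRingHom ℤ_[2]) :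
        Polynomial ℤ_[2]) : ℤ_[2]⟦X⟧) = (1 + X : ℚ_[2]⟦X⟧) ^ (2 ^ m) - 1 := by
      rw [coe_map_cyclotomicOmega, map_sub, map_pow, map_add, map_one, PowerSeries.map_X]
    rw [hωP, subst_invOnePlusSubOne_omega]
  -- homogeneity of `u_m`, `v_m`
  have hSU : (iwasawaToPowerSeries 2 (toIwasawa 2 (sharpPoly 0 2 m))).subst
      (invOnePlusSubOne : ℚ_[2]⟦X⟧) = ((invOnePlusSubOne : ℚ_[2]⟦X⟧) + 1) ^ (2 ^ m / 3) *
        iwasawaToPowerSeries 2 (toIwasawa 2 (sharpPoly 0 2 m)) := by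
    rw [iwasawaToPowerSeries_toIwasawa, subst_invOnePlusSubOne_sharpPoly_zero_two]
  have hSV : (iwasawaToPowerSeries 2 (toIwasawa 2 (flatPoly 0 2 m))).subst
      (invOnePlusSubOne : ℚ_[2]⟦X⟧) = ((invOnePlusSubOne : ℚ_[2]⟦X⟧) + 1) ^ (2 ^ m / 3) *
        iwasawaToPowerSeries 2 (toIwasawa 2 (flatPoly 0 2 m)) := by
    rw [iwasawaToPowerSeries_toIwasawa, subst_invOnePlusSubOne_flatPoly_zero_two]
  -- the congruence for `(L♯₋, L♭₋)` under `ι`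
  have hS := congrArg (PowerSeries.subst (invOnePlusSubOne : ℚ_[2]⟦X⟧)) hq
  simp only [← coe_substAlgHom hιK, map_mul, map_add, map_pow, map_ofNat] at hS
  rw [coe_substAlgHom hιK] at hS
  rw [hSU, hSV, hSω, ← iwasawaToPowerSeries_subst_invOnePlusSubOne,
    ← iwasawaToPowerSeries_subst_invOnePlusSubOne,
    ← iwasawaToPowerSeries_subst_invOnePlusSubOne] at hS
  -- units
  have hσ2 : ((ε : ℤ) : ℚ_[2]⟦X⟧) * ((ε : ℤ) : ℚ_[2]⟦X⟧) = 1 := by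
    have h := congrArg (Int.cast : ℤ → ℚ_[2]⟦X⟧) hε
    push_cast at h
    rw [← sq]; exact h
  have hPEc : (1 + X : ℚ_[2]⟦X⟧) ^ (PadicInt.toZModPow m c).val *
      ((invOnePlusSubOne : ℚ_[2]⟦X⟧) + 1) ^ (PadicInt.toZModPow m c).val = 1 :=
    one_add_X_pow_mul_E_pow _
  linear_combination
    (2 * ((ε : ℤ) : ℚ_[2]⟦X⟧) * ((invOnePlusSubOne : ℚ_[2]⟦X⟧) + 1) ^
      (PadicInt.toZModPow m c).val) * hS
    - ((2 : ℚ_[2]⟦X⟧) ^ e * ((ε : ℤ) : ℚ_[2]⟦X⟧) * ((invOnePlusSubOne : ℚ_[2]⟦X⟧) + 1) ^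
      (PadicInt.toZModPow m c).val) * hr
    - (2 * (2 : ℚ_[2]⟦X⟧) ^ e *
        (((mazurTateElementOdd f 2 m).map (algebraMap ℚ ℚ_[2]) : Polynomial ℚ_[2]) : ℚ_[2]⟦X⟧)) *
      hPEc
    - (2 * (2 : ℚ_[2]⟦X⟧) ^ e *
        (((mazurTateElementOdd f 2 m).map (algebraMap ℚ ℚ_[2]) : Polynomial ℚ_[2]) : ℚ_[2]⟦X⟧) *
        ((invOnePlusSubOne : ℚ_[2]⟦X⟧) + 1) ^ (PadicInt.toZModPow m c).val *
        (1 + X : ℚ_[2]⟦X⟧) ^ (PadicInt.toZModPow m c).val) * hσ2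
    - (2 * (2 : ℚ_[2]⟦X⟧) ^ e) * hδU - (2 * (2 : ℚ_[2]⟦X⟧) ^ e) * hδV

end Transport

end Summit.BirchSwinnertonDyer.Rank1Residual.F1Sign2

end
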